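import Literature.Probability.Percolation.SlabCircuitExtraction
import Literature.Probability.Percolation.SlabGluingRouting
import HarnessLib

/-!
# Newman–Tassion–Wu 2017, Theorem 3.10 — winding bookkeeping for open paths of the slab:
# telescoping across the cut rows, valued walks, and crossing vertices of a strip

Topic: `Literature/Probability/Percolation`. Second file of the port of THEOREM 3.10 of
Newman–Tassion–Wu, *Critical percolation and the minimal spanning tree in slabs* (CPAM 70 (2017);
arXiv:1512.09107, pp. 12–14: "we connect these two clusters at two different places in order to
create an open circuit inside the annulus").  The circuit of Theorem 3.10 is obtained
(`SlabCircuitFromLinks.lean`) from a looped open walk assembled from corner links and strip links;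
its winding number about `(½,½)` (the tree's `stepWinding`/`seqWinding`, half-line to the right at
height `½`) is computed by TELESCOPING.  This file provides the bookkeeping:

* `NTW17.indUp u z` — indicator of the rows above the cut; **`stepWinding_eq_indUp_sub`**: a lazy
  lattice step whose ends lie, on the two cut rows, strictly to the right of `u` winds by the jump
  of `indUp`; **`stepWinding_eq_zero_of_left`**: a step starting weakly to the left does not wind;
  list versions `pathWinding_eq_indUp_sub`, `pathWinding_eq_zero_of_left`.
* `pathWinding_map_proj_eq_indUp_sub` / `pathWinding_map_proj_eq_zero` — the same for open paths
  of a lattice configuration inside a planar region lying to the right / weakly to the left of the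
  origin on the cut rows `0, 1`.
* `NTW17.WalkVal k ω A a b s` — "there is an open walk inside `A` from `a` to `b` with
  `pathWinding = s`"; `WalkVal.trans` (values add), `walkVal_of_openConnIn_right/left`,
  **`circuitAround_of_walkVal`** (a loop with nonzero value in `Ā_{m,M}(0)` gives `circuitAround`).
* **`exists_crossVertex`** — for a coordinate functional `φ` that is 1-Lipschitz along lattice
  steps: an open path from `{φ < c}` to `{φ > d}` all of whose vertices with `c ≤ φ ≤ d` lie over a
  strip `X` contains a vertex over `X` on the level `φ = c` joined INSIDE `X̄` to the level `φ = d`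
  (the input of the uniqueness events `𝒰ᵢ` of NTW's proof).

## Sources

* C. M. Newman, V. Tassion, W. Wu, *Critical percolation and the minimal spanning tree in slabs*,
  Comm. Pure Appl. Math. 70 (2017) 2084–2120, arXiv:1512.09107: Theorem 3.10 and its proof
  (pp. 12–14) [NewmanTassionWu2017].
* H. Kesten, *Percolation theory for mathematicians*, Birkhäuser 1982, §2.2 (winding numbers of
  lattice paths) [KestenPTM1982].
-/

noncomputable section

namespace Literature.Probability.Percolation

open LatticeModels

namespace NTW17

variable {k : ℕ}

/-! ## Winding of a step in coordinates: telescoping and vanishing -/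

/-- Indicator of the rows strictly above the cut row `u₁`: `1` if `z₁ ≥ u₁ + 1`, else `0`.
[cite: KestenPTM1982, §2.2] -/
def indUp (u z : Site 2) : ℤ := if u 1 + 1 ≤ z 1 then 1 else 0

/-- **Telescoping of `stepWinding`.**  For a lazy lattice step `x → y` whose endpoints satisfy
"on the two cut rows `u₁, u₁+1` only strictly to the right of `u`", the winding of the step is the
jump of the indicator `indUp`. [cite: KestenPTM1982, §2.2] -/
theorem stepWinding_eq_indUp_sub {u x y : Site 2} (hxy : x = y ∨ (zdGraph 2).Adj x y)
    (hx : (x 1 = u 1 ∨ x 1 = u 1 + 1) → u 0 + 1 ≤ x 0)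
    (hy : (y 1 = u 1 ∨ y 1 = u 1 + 1) → u 0 + 1 ≤ y 0) :
    stepWinding u x y = indUp u y - indUp u x := by
  rcases hxy with rfl | hadj
  · simp [indUp]
  · rcases stepKind_of_adj hadj with ⟨h0, h1⟩ | ⟨h0, h1⟩ | ⟨h1, h0⟩ | ⟨h1, h0⟩
    · rw [stepWinding_right h0]; simp [indUp, h1]
    · rw [stepWinding_left h0]; simp [indUp, h1]
    · rw [stepWinding_up h1 h0]
      unfold indUp
      by_cases hx1 : x 1 = u 1
      · have := hx (Or.inl hx1)
        simp [hx1, h1]; omega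
      · split_ifs <;> omega
    · rw [stepWinding_down h1 h0]
      unfold indUp
      by_cases hy1 : y 1 = u 1
      · have := hy (Or.inl hy1)
        simp [hy1, h1]; omega
      · split_ifs <;> omega

/-- **Vanishing of `stepWinding`.**  A step `x → y` whose starting point is, on the two cut rows,
weakly to the left of `u` does not wind (no adjacency needed). [cite: KestenPTM1982, §2.2] -/
theorem stepWinding_eq_zero_of_left {u x y : Site 2}
    (hx : (x 1 = u 1 ∨ x 1 = u 1 + 1) → x 0 ≤ u 0) : stepWinding u x y = 0 := by
  unfold stepWinding upStep
  split_ifs with h1 h2 h3 <;> omega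

/-- Telescoping along a lazy chain all of whose points are admissible (cons form).
[cite: KestenPTM1982, §2.2] -/
theorem pathWinding_eq_indUp_sub_cons (u : Site 2) :
    ∀ (a : Site 2) (t : List (Site 2)), (a :: t).IsChain (fun x y => x = y ∨ (zdGraph 2).Adj x y) →
      (∀ z ∈ a :: t, (z 1 = u 1 ∨ z 1 = u 1 + 1) → u 0 + 1 ≤ z 0) →
      pathWinding u (a :: t) = indUp u ((a :: t).getLast (List.cons_ne_nil a t)) - indUp u a := by
  intro a t
  induction t generalizing a with
  | nil => intro _ _; simp
  | cons b t ih =>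
    intro hc hadm
    rw [List.isChain_cons_cons] at hc
    rw [pathWinding_cons_cons, ih b hc.2 (fun z hz => hadm z (List.mem_cons_of_mem a hz)),
      stepWinding_eq_indUp_sub hc.1 (hadm a (by simp)) (hadm b (by simp)), List.getLast_cons_cons]
    ring

/-- **Telescoping along a lazy chain all of whose points are admissible**:
`pathWinding = indUp(last) - indUp(first)`. [cite: KestenPTM1982, §2.2] -/
theorem pathWinding_eq_indUp_sub (u : Site 2) (l : List (Site 2)) (hl : l ≠ [])
    (hc : l.IsChain (fun x y => x = y ∨ (zdGraph 2).Adj x y))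
    (hadm : ∀ z ∈ l, (z 1 = u 1 ∨ z 1 = u 1 + 1) → u 0 + 1 ≤ z 0) :
    pathWinding u l = indUp u (l.getLast hl) - indUp u (l.head hl) := by
  obtain ⟨a, t, rfl⟩ := List.exists_cons_of_ne_nil hl
  exact pathWinding_eq_indUp_sub_cons u a t hc hadm

/-- A chain all of whose points are weakly to the left of `u` on the cut rows does not wind.
[cite: KestenPTM1982, §2.2] -/
theorem pathWinding_eq_zero_of_left (u : Site 2) :
    ∀ (l : List (Site 2)), (∀ z ∈ l, (z 1 = u 1 ∨ z 1 = u 1 + 1) → z 0 ≤ u 0) → pathWinding u l = 0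
  | [], _ => rfl
  | [_], _ => rfl
  | a :: b :: t, h => by
    rw [pathWinding_cons_cons, stepWinding_eq_zero_of_left (h a (by simp)),
      pathWinding_eq_zero_of_left u (b :: t) (fun z hz => h z (List.mem_cons_of_mem a hz))]
    simp

/-! ## Planar shadows of open paths of a lattice configuration -/

/-- Consecutive vertices of an open path of a lattice configuration have equal or adjacent planar
parts. [cite: NewmanTassionWu2017, §2 Notation (the projection π)] -/
theorem planar_rel_of_open {ω : BondConfig (slab 3 k)} (hω : ω ⊆ (slabGraph 3 k).edgeSet)
    {x y : slab 3 k} (h : s(x, y) ∈ ω ∧ x ≠ y) :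
    planar k x = planar k y ∨ planarAdj (planar k x) (planar k y) := by
  have hadj : (slabGraph 3 k).Adj x y := (SimpleGraph.mem_edgeSet _).1 (hω h.1)
  rcases (slab_adj_iff x y).1 hadj with ⟨-, hp⟩ | ⟨hp, -⟩
  · exact Or.inr hp
  · exact Or.inl hp

/-- The projection of an open path of a lattice configuration is a lazy lattice chain.
[cite: NewmanTassionWu2017, §2 Notation (the projection π)] -/
theorem isChain_map_proj {ω : BondConfig (slab 3 k)} (hω : ω ⊆ (slabGraph 3 k).edgeSet)
    {l : List (slab 3 k)} (hl : l.IsChain (fun a b => s(a, b) ∈ ω ∧ a ≠ b)) :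
    (l.map (proj k)).IsChain (fun x y => x = y ∨ (zdGraph 2).Adj x y) :=
  List.isChain_map_of_isChain (proj k) (fun _ _ h => proj_rel_of_open hω h) hl

/-- Coordinates of the projection. [cite: NewmanTassionWu2017, §2 Notation (the projection π)] -/
@[simp] theorem proj_apply_zero (x : slab 3 k) : proj k x 0 = (planar k x).1 := rfl

/-- Coordinates of the projection. [cite: NewmanTassionWu2017, §2 Notation (the projection π)] -/
@[simp] theorem proj_apply_one (x : slab 3 k) : proj k x 1 = (planar k x).2 := rfl

/-- `planarAdj` changes each coordinate by at most one. [cite: NewmanTassionWu2017, §2 Notation (the lattice ℤ²)] -/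
theorem abs_sub_le_one_of_planarAdj {z w : ℤ × ℤ} (h : planarAdj z w) :
    w.1 ≤ z.1 + 1 ∧ z.1 ≤ w.1 + 1 ∧ w.2 ≤ z.2 + 1 ∧ z.2 ≤ w.2 + 1 := by
  rcases h with (h | h) | (h | h) <;>
    · rw [Prod.ext_iff] at h; simp only [Prod.fst_add, Prod.snd_add] at h; omega

/-! ## Telescoping for open paths inside a planar region -/

/-- **The winding of an open path inside a region whose cut-row points lie to the right of the
origin** (about `(½,½)`): `pathWinding = indUp(last) - indUp(first)`.
[cite: NewmanTassionWu2017, Theorem 3.10 (proof)] -/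
theorem pathWinding_map_proj_eq_indUp_sub {ω : BondConfig (slab 3 k)} (hω : ω ⊆ (slabGraph 3 k).edgeSet)
    {Ω : Set (ℤ × ℤ)} (hΩ : ∀ z ∈ Ω, (z.2 = 0 ∨ z.2 = 1) → 1 ≤ z.1)
    {l : List (slab 3 k)} (hne : l ≠ []) (hl : l.IsChain (fun a b => s(a, b) ∈ ω ∧ a ≠ b))
    (hsub : ∀ x ∈ l, x ∈ slabLift k Ω) :
    pathWinding (ts (0, 0)) (l.map (proj k)) =
      indUp (ts (0, 0)) (proj k (l.getLast hne)) - indUp (ts (0, 0)) (proj k (l.head hne)) := by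
  have hc := isChain_map_proj hω hl
  have hne' : l.map (proj k) ≠ [] := by simpa using hne
  rw [pathWinding_eq_indUp_sub (ts (0, 0)) (l.map (proj k)) hne' hc, List.getLast_map, List.head_map]
  intro z hz
  rw [List.mem_map] at hz
  obtain ⟨x, hx, rfl⟩ := hz
  have hxΩ : planar k x ∈ Ω := hsub x hx
  simp only [proj_apply_one, ts_apply_one, proj_apply_zero, ts_apply_zero, zero_add]
  intro h01
  exact hΩ _ hxΩ h01

/-- **An open path inside a region whose cut-row points lie weakly to the left of the origin does
not wind** (about `(½,½)`). [cite: NewmanTassionWu2017, Theorem 3.10 (proof)] -/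
theorem pathWinding_map_proj_eq_zero
    {Ω : Set (ℤ × ℤ)} (hΩ : ∀ z ∈ Ω, (z.2 = 0 ∨ z.2 = 1) → z.1 ≤ 0)
    {l : List (slab 3 k)} (hsub : ∀ x ∈ l, x ∈ slabLift k Ω) :
    pathWinding (ts (0, 0)) (l.map (proj k)) = 0 := by
  refine pathWinding_eq_zero_of_left _ _ fun z hz => ?_
  rw [List.mem_map] at hz
  obtain ⟨x, hx, rfl⟩ := hz
  have hxΩ : planar k x ∈ Ω := hsub x hx
  simp only [proj_apply_one, ts_apply_one, proj_apply_zero, ts_apply_zero, zero_add]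
  intro h01
  exact hΩ _ hxΩ h01

/-! ## Walks with a winding value, inside a fixed vertex set -/

/-- `WalkVal k ω A a b s`: there is an `ω`-open walk inside `A` from `a` to `b` (consecutive vertices
distinct, joined by open edges) whose projection has `pathWinding = s` about `(½,½)`.
[cite: NewmanTassionWu2017, Theorem 3.10 (proof)] -/
def WalkVal (k : ℕ) (ω : BondConfig (slab 3 k)) (A : Set (slab 3 k)) (a b : slab 3 k) (s : ℤ) : Prop :=
  ∃ (L : List (slab 3 k)) (hL : L ≠ []), L.IsChain (fun x y => s(x, y) ∈ ω ∧ x ≠ y) ∧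
    (∀ x ∈ L, x ∈ A) ∧ L.head hL = a ∧ L.getLast hL = b ∧ pathWinding (ts (0, 0)) (L.map (proj k)) = s

/-- **Concatenation of valued walks**: the values add. [cite: NewmanTassionWu2017, Theorem 3.10 (proof)] -/
theorem WalkVal.trans {ω : BondConfig (slab 3 k)} {A : Set (slab 3 k)} {a b c : slab 3 k} {s t : ℤ}
    (h₁ : WalkVal k ω A a b s) (h₂ : WalkVal k ω A b c t) : WalkVal k ω A a c (s + t) := by
  obtain ⟨L, hL, hLc, hLA, hLh, hLl, hLw⟩ := h₁
  obtain ⟨M, hM, hMc, hMA, hMh, hMl, hMw⟩ := h₂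
  refine ⟨L ++ M.tail, by simp [hL], ?_, ?_, ?_, ?_, ?_⟩
  · -- chain: overlap at `b`
    have hM' : M = b :: M.tail := by rw [← hMh]; exact (List.cons_head_tail hM).symm
    have hL' : L = L.dropLast ++ [b] := by rw [← hLl]; exact (List.dropLast_append_getLast hL).symm
    have h2 : ([b] ++ M.tail).IsChain (fun x y => s(x, y) ∈ ω ∧ x ≠ y) := by
      rw [List.singleton_append, ← hM']; exact hMc
    have := List.IsChain.append_overlap (hL' ▸ hLc) h2 (List.cons_ne_nil b [])
    rwa [← hL'] at this
  · intro x hx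
    rw [List.mem_append] at hx
    rcases hx with hx | hx
    · exact hLA x hx
    · exact hMA x (List.mem_of_mem_tail hx)
  · rw [List.head_append_of_ne_nil hL]; exact hLh
  · by_cases hMt : M.tail = []
    · simp only [hMt, List.append_nil]
      rw [hLl, ← hMl]
      have hM' : M = [b] := by rw [← List.cons_head_tail hM, hMt, hMh]
      subst hM'; rfl
    · rw [List.getLast_append_of_ne_nil _ hMt, List.getLast_tail]; exact hMl
  · rw [List.map_append, List.map_tail, pathWinding_append_of_head_eq (ts (0, 0)) (by simp [hL]) (by simp [hM]),
      hLw, hMw]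
    rw [List.head_map, List.getLast_map, hMh, hLl]

/-- A valued walk from an open connection inside a region to the RIGHT of the origin on the cut
rows: value `indUp(end) - indUp(start)`. [cite: NewmanTassionWu2017, Theorem 3.10 (proof)] -/
theorem walkVal_of_openConnIn_right {ω : BondConfig (slab 3 k)} (hω : ω ⊆ (slabGraph 3 k).edgeSet)
    {Ω : Set (ℤ × ℤ)} (hΩ : ∀ z ∈ Ω, (z.2 = 0 ∨ z.2 = 1) → 1 ≤ z.1) {A : Set (slab 3 k)}
    (hΩA : slabLift k Ω ⊆ A) {a b : slab 3 k} (h : ω ∈ openConnIn (slabLift k Ω) a b) :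
    WalkVal k ω A a b (indUp (ts (0, 0)) (proj k b) - indUp (ts (0, 0)) (proj k a)) := by
  obtain ⟨l, hl⟩ := exists_isOSAP_of_openConnIn h
  have hh : l.head hl.ne_nil = a := hl.head_mem hl.ne_nil
  have hla : l.getLast hl.ne_nil = b := hl.last_mem hl.ne_nil
  refine ⟨l, hl.ne_nil, hl.chain, fun x hx => hΩA (hl.subset x hx), hh, hla, ?_⟩
  rw [pathWinding_map_proj_eq_indUp_sub hω hΩ hl.ne_nil hl.chain hl.subset, hh, hla]

/-- A valued walk from an open connection inside a region weakly to the LEFT of the origin on the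
cut rows: value `0`. [cite: NewmanTassionWu2017, Theorem 3.10 (proof)] -/
theorem walkVal_of_openConnIn_left {ω : BondConfig (slab 3 k)}
    {Ω : Set (ℤ × ℤ)} (hΩ : ∀ z ∈ Ω, (z.2 = 0 ∨ z.2 = 1) → z.1 ≤ 0) {A : Set (slab 3 k)}
    (hΩA : slabLift k Ω ⊆ A) {a b : slab 3 k} (h : ω ∈ openConnIn (slabLift k Ω) a b) :
    WalkVal k ω A a b 0 := by
  obtain ⟨l, hl⟩ := exists_isOSAP_of_openConnIn h
  exact ⟨l, hl.ne_nil, hl.chain, fun x hx => hΩA (hl.subset x hx), hl.head_mem hl.ne_nil,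
    hl.last_mem hl.ne_nil, pathWinding_map_proj_eq_zero hΩ hl.subset⟩

/-- **A valued loop with nonzero value in an annulus gives `circuitAround`.**
[cite: NewmanTassionWu2017, Theorem 3.10 (proof, "would imply the existence of a circuit")] -/
theorem circuitAround_of_walkVal {ω : BondConfig (slab 3 k)} {m M : ℕ} {a : slab 3 k} {s : ℤ}
    (h : WalkVal k ω (slabLift k (annulus (0, 0) m M)) a a s) (hs : s ≠ 0) :
    ω ∈ circuitAround k (0, 0) m M := by
  obtain ⟨L, hL, hLc, hLA, hLh, hLl, hLw⟩ := h
  exact circuitAround_of_loop hL hLc hLA (hLh.trans hLl.symm) (by rw [hLw]; exact hs)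

/-! ## Crossing vertices of a strip -/

/-- **Reaching the far end inside the strip.**  Let `φ` be a planar functional changing by at most
one along lattice steps, and let an open path of a lattice configuration start at a vertex with
`φ ≤ d`, never go below `c`, and contain a vertex with `φ > d`; if all its vertices with
`c ≤ φ ≤ d` lie over `X`, then its starting vertex is joined inside `X̄` to a vertex with `φ = d`.
[cite: NewmanTassionWu2017, Theorem 3.10 (proof, the unique crossing clusters)] -/
theorem exists_reach_level_of_chain {ω : BondConfig (slab 3 k)} (hω : ω ⊆ (slabGraph 3 k).edgeSet)
    {φ : ℤ × ℤ → ℤ} (hφ : ∀ z w, planarAdj z w → φ w ≤ φ z + 1) {X : Set (ℤ × ℤ)} {c d : ℤ} :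
    ∀ (v : slab 3 k) (t : List (slab 3 k)), (v :: t).IsChain (fun a b => s(a, b) ∈ ω ∧ a ≠ b) →
      (∀ z ∈ v :: t, c ≤ φ (planar k z) → φ (planar k z) ≤ d → planar k z ∈ X) →
      (∀ z ∈ v :: t, c ≤ φ (planar k z)) → φ (planar k v) ≤ d →
      (∃ z ∈ v :: t, d < φ (planar k z)) →
      ∃ e ∈ v :: t, φ (planar k e) = d ∧ ω ∈ openConnIn (slabLift k X) v e := by
  intro v t
  induction t generalizing v with
  | nil =>
    intro _ _ _ hvd hex
    obtain ⟨z, hz, hzd⟩ := hex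
    rw [List.mem_singleton] at hz
    subst hz
    omega
  | cons w t ih =>
    intro hc hX hlow hvd hex
    rw [List.isChain_cons_cons] at hc
    have hvX : v ∈ slabLift k X := hX v (by simp) (hlow v (by simp)) hvd
    have hstep : φ (planar k w) ≤ φ (planar k v) + 1 := by
      rcases planar_rel_of_open hω hc.1 with he | ha
      · rw [he]; omega
      · exact hφ _ _ ha
    by_cases hwd : d < φ (planar k w)
    · -- the next vertex is beyond the level: `v` is on the level
      refine ⟨v, by simp, by omega, openConnIn_refl hvX⟩
    · rw [not_lt] at hwd
      have hex' : ∃ z ∈ w :: t, d < φ (planar k z) := by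
        obtain ⟨z, hz, hzd⟩ := hex
        rw [List.mem_cons] at hz
        rcases hz with rfl | hz
        · omega
        · exact ⟨z, hz, hzd⟩
      obtain ⟨e, he, hed, hwe⟩ := ih w hc.2 (fun z hz => hX z (List.mem_cons_of_mem v hz))
        (fun z hz => hlow z (List.mem_cons_of_mem v hz)) hwd hex'
      have hwX : w ∈ slabLift k X := hX w (by simp) (hlow w (by simp)) hwd
      exact ⟨e, List.mem_cons_of_mem v he, hed,
        SlabCriticality.openConnIn_trans (openConnIn_of_adj hvX hwX hc.1.1 hc.1.2) hwe⟩

/-- **A path crossing a strip has a crossing vertex.**  With `φ` as above: an open path of a lattice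
configuration from a vertex with `φ < c` to a vertex with `φ > d` (`c ≤ d`), all of whose vertices
with `c ≤ φ ≤ d` lie over `X`, contains a vertex `v` over `X` with `φ(v) = c` which is joined inside
`X̄` to a vertex `e` with `φ(e) = d`. [cite: NewmanTassionWu2017, Theorem 3.10 (proof, the unique crossing clusters)] -/
theorem exists_crossVertex {ω : BondConfig (slab 3 k)} (hω : ω ⊆ (slabGraph 3 k).edgeSet)
    {φ : ℤ × ℤ → ℤ} (hφ : ∀ z w, planarAdj z w → φ w ≤ φ z + 1) {X : Set (ℤ × ℤ)} {c d : ℤ}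
    (hcd : c ≤ d) {l : List (slab 3 k)} (hne : l ≠ [])
    (hl : l.IsChain (fun a b => s(a, b) ∈ ω ∧ a ≠ b))
    (hX : ∀ z ∈ l, c ≤ φ (planar k z) → φ (planar k z) ≤ d → planar k z ∈ X)
    (hhead : φ (planar k (l.head hne)) < c) (hlast : d < φ (planar k (l.getLast hne))) :
    ∃ v ∈ l, planar k v ∈ X ∧ φ (planar k v) = c ∧
      ∃ e, φ (planar k e) = d ∧ ω ∈ openConnIn (slabLift k X) v e := by
  -- split at the last vertex below `c`
  obtain ⟨l₁, p, l₂, hsplit, hp, hno⟩ :=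
    exists_last_split (p := fun z => φ (planar k z) < c) l ⟨l.head hne, List.head_mem hne, hhead⟩
  have hl₂ : l₂ ≠ [] := by
    intro h0
    rw [h0] at hsplit
    have : l.getLast hne = p := by simp [hsplit]
    rw [this] at hlast
    have hp' : φ (planar k p) < c := hp
    omega
  obtain ⟨v, t, rfl⟩ := List.exists_cons_of_ne_nil hl₂
  have hc2 : (p :: v :: t).IsChain (fun a b => s(a, b) ∈ ω ∧ a ≠ b) := by
    rw [hsplit] at hl; exact hl.right_of_append
  rw [List.isChain_cons_cons] at hc2
  have hvc : φ (planar k v) = c := by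
    have h1 : ¬φ (planar k v) < c := hno v (by simp)
    have hstep : φ (planar k v) ≤ φ (planar k p) + 1 := by
      rcases planar_rel_of_open hω hc2.1 with he | ha
      · rw [he]; omega
      · exact hφ _ _ ha
    have hp' : φ (planar k p) < c := hp
    omega
  have hmem : ∀ z ∈ v :: t, z ∈ l := fun z hz => by
    rw [hsplit]; exact List.mem_append_right _ (List.mem_cons_of_mem p hz)
  have hlow : ∀ z ∈ v :: t, c ≤ φ (planar k z) := fun z hz => by
    have := hno z hz; simp only [not_lt] at this; exact this
  have hex : ∃ z ∈ v :: t, d < φ (planar k z) := by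
    refine ⟨l.getLast hne, ?_, hlast⟩
    have : l.getLast hne = (v :: t).getLast (List.cons_ne_nil v t) := by
      simp [hsplit, List.getLast_append_of_ne_nil]
    rw [this]; exact List.getLast_mem _
  obtain ⟨e, -, hed, hve⟩ := exists_reach_level_of_chain hω hφ v t hc2.2
    (fun z hz => hX z (hmem z hz)) hlow (by omega) hex
  exact ⟨v, hmem v (by simp), hX v (hmem v (by simp)) (by omega) (by omega), hvc, e, hed, hve⟩

end NTW17

end Literature.Probability.Percolation

end
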